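import Summits.Ventures.PercRepro.RankLevelSetExplicitLin2KeyQuart

/-!
# PercRepro — THE LEVEL-12 QUART ROW OF C-025: THE KEY AT `p = 8 764` AND THE CONDITIONAL LEVEL STEP (p9, S4)

`proofs/SUBCLAIM-S4-p9.md` §S4.2⁗‴. The saturated row of record at level `12` is `p ≥ 40 204` (RankLevelSetExplicitLin2RowTwelve).
With p4's quart multiplicity the assembled inequality `(P_d)` holds, exactly evaluated, at EVERY core corank `13 ≤ d ≤ 4108`
from `p = 8 764` — and fails at `p = 8 763` (corank `2 547`, the big class's saturation corank):
the quart key `KeyQ 12 8764 d` (RankLevelSetExplicitLin2KeyQuart) is checked by the kernel at the 4 096 coranks (`decide`, 1 chunk of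
4 096), and `c025_level_succ_of_keyQ_row` turns the row into the level step
**`c025_twelve_quart_step (hprev : ∀ M p, 8 763 ≤ p → RLS M p 11) : ∀ M p, 8 764 ≤ p → RLS M p 12`** (N₁(12) = 8 532,
tail `8 257`). The unconditional rows are composed in RankLevelSetExplicitLin2QuartFloor. Axioms: standard.
-/

open scoped Matroid

namespace PercRepro

namespace ThmN

namespace Explicit

/-- **THE QUART KEY ROW AT `(q, p) = (12, 8 764)`**: `KeyQ 12 8764 d` at every corank `13 ≤ d ≤ 4108`, by the kernel. -/
theorem key_twelve_quart_row : ∀ t < 4096, KeyQ 12 8764 (13 + t) := by decide +kernel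

/-- **THE QUART FLOOR IS EXACT**: the quart key FAILS at `p = 8 763`, corank `2 547` (the big class's saturation corank), by the kernel. -/
theorem key_twelve_quart_sharp : ¬ KeyQ 12 8763 2547 := by decide +kernel

end Explicit

variable {α : Type}

/-- **THE LEVEL-12 QUART STEP FROM `8 764`**: level `12` for every finite matroid and every `p ≥ 8 764` from level `11` for
every `p ≥ 8 763` — the quart key row at `8 764`, its monotonicity in `p`, and the wrapper `c025_level_succ_of_keyQ_row`
(`N₁(12) = 8 532 ≤ 8 764`, tail `8 257 ≤ 8 764`). -/
theorem c025_twelve_quart_step (hprev : ∀ (M : Matroid α) [M.Finite] (p : ℕ), 8763 ≤ p → RLS M p 11) :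
    ∀ (M : Matroid α) [M.Finite] (p : ℕ), 8764 ≤ p → RLS M p 12 :=
  c025_level_succ_of_keyQ_row 11 (by norm_num) 8764 (by norm_num) (by norm_num) Explicit.key_twelve_quart_row hprev

end ThmN

end PercRepro
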